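import Summits.ResolutionOfSingularities.ResolutionOfSingularities.Theorems.HilbertSamuelEliminationSigmaMaxModificationsCorridor3SigmaRowRunPFrameGoodLaws
import Summits.ResolutionOfSingularities.ResolutionOfSingularities.Theorems.HilbertSamuelEliminationSigmaMaxModificationsCorridor3SigmaRowRunPS1T
import HarnessLib

/-!
# [OURS · L1 W4.2] ENGINE-I «ROW-P» — THE INSTANCE, FILE C″ (kernel lane): the `T`-GUARDED transport laws `GuardedLawsT` (res-L1-type-o1's PS1T, p577660 —
# res-L1-w42-tri-2 FLAG B-2) of the SCOPED instance `RowEngine.incidenceGood`, ASSEMBLED — three laws PROVED (`eta_antitone`, `E_total`, `Eminus_nonempty`,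
# FILE C′), `dbl_nonempty` derived, FIVE geometric laws named over GOOD states with `η ≤ 3` now asked ON THE ROW STRATUM ONLY; no-reactivation along the instance
# (cell res-hironaka, LADDER-RESOLUTION rung L; slot W4.2, crux chain w42 `SigmaMaxModificationsCorridor3` stmt-ResolutionOfSingularities-19249 / crux
# stmt-…-18506; RULING v3.14-51a (51a-F), res-plan-2 DEAL #81 (1) → seat res-D-pv-060 g9; `--supports stmt-ResolutionOfSingularities-19249 --as helper`, counted 0)

HONEST FRAMING. OURS proof bookkeeping over FILE A′/C′ (`…RowRunPFrameGood`, `…RowRunPFrameGoodLaws`) and o1's `…RowRunPS1T` (`PIncidence.GuardedLawsT`,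
`GuardedLawsT.doneN_reach`, `eta_eq_zero_of_doneN_five`). SUPERSEDES BY NAME `RowEngine.guardedLaws_incidenceGood` (unguarded `η ≤ 3`, not dischargeable on
the intended scope: honest σ-runs have quadruple points of `E⁻` off the contact hypersurfaces — tri-2 B-2, tri-1 concurring). Nothing here is a statement of
H. Hironaka's manuscript [Hironaka2017] (CANDIDATE, never a premise) nor of [Cutkosky2009] (shapes only). Every declaration a PROVED `theorem`. AI-written, weaker
than expert review.

* **`RowEngine.guardedLawsT_incidenceGood`** — `(incidenceGood rd sc).toPIncidence.GuardedLawsT` from FIVE named laws over GOOD states: `eta_le_three :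
  ∀ s x, x ∈ T s → η ≤ 3` (dischargeable on the FIRST-LAYER contact chart: `T ∩ U ⊆ V(H_I)` by (c3), `H :: E|_U` snc, `ne_H` — FILE D2), `dbl_map`, `Eminus_map`
  (over live members, ONTO when meeting `T′`), `surf_map`, `freeCurve_map`, + `curveComp_nonempty` (a law OF the readings `rd`); `eta_antitone` / `E_total` /
  `Eminus_nonempty` discharged by FILE C′, `dbl_nonempty` derived.
* `RowEngine.doneNT_reach_incidenceGood` — NO-REACTIVATION along the scoped instance (o1's `GuardedLawsT.doneN_reach`);
  `RowEngine.eta_eq_zero_of_doneNT_five_incidenceGood` — Thm 7.2 (1) in exhausted form on `T` (o1's `GuardedLawsT.eta_eq_zero_of_doneN_five`).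

References: Cutkosky, Amer. J. Math. 131 (2009), Def. 5.4–5.5, Lemma 5.1 (1), Thm 7.2 [Cutkosky2009] (shapes only).
-/

set_option linter.dupNamespace false -- mandated namespace of this single-conjunct summit

noncomputable section

open CategoryTheory AlgebraicGeometry TopologicalSpace
open Literature.AlgebraicGeometry.Resolution Literature.AlgebraicGeometry.Cutkosky2009.DatumReduction
open Summit.ResolutionOfSingularities.ResolutionOfSingularities.Theorems.SigmaMaxModificationsCorridor3.Sigma

namespace Summit.ResolutionOfSingularities.ResolutionOfSingularities.Theorems.SigmaMaxModificationsCorridor3.RowRunP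

universe u

namespace RowEngine

variable {m S₀ : ℕ} (eng : RowEngine.{u} m S₀) (rd : RowReadings.{u}) (sc : eng.Scope)

/-- [OURS · L1 W4.2] **THE `T`-GUARDED TRANSPORT LAWS OF THE SCOPED INSTANCE, ASSEMBLED** (supersedes `guardedLaws_incidenceGood`: `η ≤ 3` is asked on `T s` only,
tri-2 B-2). [cite: Cutkosky2009, Def. 5.5, Lemma 5.1 (1)] -/
theorem guardedLawsT_incidenceGood
    (eta_le_three : ∀ (s : (RowRunFrame.ofRowGood m S₀ eng sc).St) (x : ULift.{u + 1} s.1.W),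
      x ∈ (RowRunFrame.ofRowGood m S₀ eng sc).T s → s.1.eta x ≤ 3)
    (dbl_map : ∀ {s s' : (RowRunFrame.ofRowGood m S₀ eng sc).St} (h : (RowRunFrame.ofRowGood m S₀ eng sc).Move s s')
      (D' : Set (ULift.{u + 1} s'.1.W)), D' ∈ rd.dblCurves s'.1 → (D' ∩ (RowRunFrame.ofRowGood m S₀ eng sc).T s').Nonempty →
      ∃ D ∈ rd.dblCurves s.1, (RowRunFrame.ofRowGood m S₀ eng sc).ptMap h '' D' = D)
    (Eminus_map : ∀ {s s' : (RowRunFrame.ofRowGood m S₀ eng sc).St} (h : (RowRunFrame.ofRowGood m S₀ eng sc).Move s s')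
      (Fc' : Set (ULift.{u + 1} s'.1.W)), Fc' ∈ s'.1.eminusLive → (Fc' ∩ (RowRunFrame.ofRowGood m S₀ eng sc).T s').Nonempty →
      ∃ Fc ∈ s.1.eminusLive, (RowRunFrame.ofRowGood m S₀ eng sc).ptMap h '' Fc' = Fc)
    (surf_map : ∀ {s s' : (RowRunFrame.ofRowGood m S₀ eng sc).St} (h : (RowRunFrame.ofRowGood m S₀ eng sc).Move s s')
      (S' : Set (ULift.{u + 1} s'.1.W)), S' ∈ rd.surfCompsIn s'.1 ((RowRunFrame.ofRowGood m S₀ eng sc).T s') →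
      (RowRunFrame.ofRowGood m S₀ eng sc).ptMap h '' S' ∈ rd.surfCompsIn s.1 ((RowRunFrame.ofRowGood m S₀ eng sc).T s))
    (freeCurve_map : ∀ {s s' : (RowRunFrame.ofRowGood m S₀ eng sc).St} (h : (RowRunFrame.ofRowGood m S₀ eng sc).Move s s')
      (C' : Set (ULift.{u + 1} s'.1.W)), C' ∈ (eng.incidenceGood rd sc).freeCurves s' →
      ¬ (rd.surfCompsIn s.1 ((RowRunFrame.ofRowGood m S₀ eng sc).T s)).Nonempty →
      (RowRunFrame.ofRowGood m S₀ eng sc).ptMap h '' C' ∈ rd.curveCompsIn s.1 ((RowRunFrame.ofRowGood m S₀ eng sc).T s))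
    (curveComp_nonempty : ∀ (s : (RowRunFrame.ofRowGood m S₀ eng sc).St) (A C : Set (ULift.{u + 1} s.1.W)), C ∈ rd.curveCompsIn s.1 A → C.Nonempty) :
    (eng.incidenceGood rd sc).toPIncidence.GuardedLawsT where
  eta_le_three := eta_le_three
  eta_antitone h q _ := eng.incidenceGood_eta_antitone rd sc h q
  dbl_map := dbl_map
  Eminus_map := Eminus_map
  dbl_nonempty s D hD := by
    obtain ⟨I, -, I', -, -, hDc⟩ := hD
    exact curveComp_nonempty s _ D hDc
  Eminus_nonempty s Fc h := eng.incidenceGood_Eminus_nonempty rd sc s Fc h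
  E_total h q hq := eng.incidenceGood_E_total rd sc h q hq
  surf_map := surf_map
  freeCurve_map := freeCurve_map
  curveComp_nonempty := curveComp_nonempty

/-- **NO-REACTIVATION along the scoped instance under the `T`-guarded laws** (o1's `GuardedLawsT.doneN_reach`). [cite: Cutkosky2009, Thm 7.2 proof p. 21–23] -/
theorem doneNT_reach_incidenceGood
    (eta_le_three : ∀ (s : (RowRunFrame.ofRowGood m S₀ eng sc).St) (x : ULift.{u + 1} s.1.W),
      x ∈ (RowRunFrame.ofRowGood m S₀ eng sc).T s → s.1.eta x ≤ 3)
    (dbl_map : ∀ {s s' : (RowRunFrame.ofRowGood m S₀ eng sc).St} (h : (RowRunFrame.ofRowGood m S₀ eng sc).Move s s')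
      (D' : Set (ULift.{u + 1} s'.1.W)), D' ∈ rd.dblCurves s'.1 → (D' ∩ (RowRunFrame.ofRowGood m S₀ eng sc).T s').Nonempty →
      ∃ D ∈ rd.dblCurves s.1, (RowRunFrame.ofRowGood m S₀ eng sc).ptMap h '' D' = D)
    (Eminus_map : ∀ {s s' : (RowRunFrame.ofRowGood m S₀ eng sc).St} (h : (RowRunFrame.ofRowGood m S₀ eng sc).Move s s')
      (Fc' : Set (ULift.{u + 1} s'.1.W)), Fc' ∈ s'.1.eminusLive → (Fc' ∩ (RowRunFrame.ofRowGood m S₀ eng sc).T s').Nonempty →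
      ∃ Fc ∈ s.1.eminusLive, (RowRunFrame.ofRowGood m S₀ eng sc).ptMap h '' Fc' = Fc)
    (surf_map : ∀ {s s' : (RowRunFrame.ofRowGood m S₀ eng sc).St} (h : (RowRunFrame.ofRowGood m S₀ eng sc).Move s s')
      (S' : Set (ULift.{u + 1} s'.1.W)), S' ∈ rd.surfCompsIn s'.1 ((RowRunFrame.ofRowGood m S₀ eng sc).T s') →
      (RowRunFrame.ofRowGood m S₀ eng sc).ptMap h '' S' ∈ rd.surfCompsIn s.1 ((RowRunFrame.ofRowGood m S₀ eng sc).T s))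
    (freeCurve_map : ∀ {s s' : (RowRunFrame.ofRowGood m S₀ eng sc).St} (h : (RowRunFrame.ofRowGood m S₀ eng sc).Move s s')
      (C' : Set (ULift.{u + 1} s'.1.W)), C' ∈ (eng.incidenceGood rd sc).freeCurves s' →
      ¬ (rd.surfCompsIn s.1 ((RowRunFrame.ofRowGood m S₀ eng sc).T s)).Nonempty →
      (RowRunFrame.ofRowGood m S₀ eng sc).ptMap h '' C' ∈ rd.curveCompsIn s.1 ((RowRunFrame.ofRowGood m S₀ eng sc).T s))
    (curveComp_nonempty : ∀ (s : (RowRunFrame.ofRowGood m S₀ eng sc).St) (A C : Set (ULift.{u + 1} s.1.W)), C ∈ rd.curveCompsIn s.1 A → C.Nonempty)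
    {s s' : (RowRunFrame.ofRowGood m S₀ eng sc).St} (hr : (RowRunFrame.ofRowGood m S₀ eng sc).Reach s s') (k : ℕ)
    (hs : (eng.incidenceGood rd sc).toPIncidence.DoneN k s) : (eng.incidenceGood rd sc).toPIncidence.DoneN k s' :=
  (eng.guardedLawsT_incidenceGood rd sc eta_le_three dbl_map Eminus_map surf_map freeCurve_map curveComp_nonempty).doneN_reach k hr hs

/-- **Thm 7.2 (1), exhausted form, for the scoped instance**: at ladder level `5` (classes (A1)–(A4) and the η-one class done), `η` vanishes on the row stratum
(o1's `GuardedLawsT.eta_eq_zero_of_doneN_five`). [cite: Cutkosky2009, Thm 7.2 (1) p. 21] -/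
theorem eta_eq_zero_of_doneNT_five_incidenceGood
    (eta_le_three : ∀ (s : (RowRunFrame.ofRowGood m S₀ eng sc).St) (x : ULift.{u + 1} s.1.W),
      x ∈ (RowRunFrame.ofRowGood m S₀ eng sc).T s → s.1.eta x ≤ 3)
    (dbl_map : ∀ {s s' : (RowRunFrame.ofRowGood m S₀ eng sc).St} (h : (RowRunFrame.ofRowGood m S₀ eng sc).Move s s')
      (D' : Set (ULift.{u + 1} s'.1.W)), D' ∈ rd.dblCurves s'.1 → (D' ∩ (RowRunFrame.ofRowGood m S₀ eng sc).T s').Nonempty →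
      ∃ D ∈ rd.dblCurves s.1, (RowRunFrame.ofRowGood m S₀ eng sc).ptMap h '' D' = D)
    (Eminus_map : ∀ {s s' : (RowRunFrame.ofRowGood m S₀ eng sc).St} (h : (RowRunFrame.ofRowGood m S₀ eng sc).Move s s')
      (Fc' : Set (ULift.{u + 1} s'.1.W)), Fc' ∈ s'.1.eminusLive → (Fc' ∩ (RowRunFrame.ofRowGood m S₀ eng sc).T s').Nonempty →
      ∃ Fc ∈ s.1.eminusLive, (RowRunFrame.ofRowGood m S₀ eng sc).ptMap h '' Fc' = Fc)
    (surf_map : ∀ {s s' : (RowRunFrame.ofRowGood m S₀ eng sc).St} (h : (RowRunFrame.ofRowGood m S₀ eng sc).Move s s')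
      (S' : Set (ULift.{u + 1} s'.1.W)), S' ∈ rd.surfCompsIn s'.1 ((RowRunFrame.ofRowGood m S₀ eng sc).T s') →
      (RowRunFrame.ofRowGood m S₀ eng sc).ptMap h '' S' ∈ rd.surfCompsIn s.1 ((RowRunFrame.ofRowGood m S₀ eng sc).T s))
    (freeCurve_map : ∀ {s s' : (RowRunFrame.ofRowGood m S₀ eng sc).St} (h : (RowRunFrame.ofRowGood m S₀ eng sc).Move s s')
      (C' : Set (ULift.{u + 1} s'.1.W)), C' ∈ (eng.incidenceGood rd sc).freeCurves s' →
      ¬ (rd.surfCompsIn s.1 ((RowRunFrame.ofRowGood m S₀ eng sc).T s)).Nonempty →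
      (RowRunFrame.ofRowGood m S₀ eng sc).ptMap h '' C' ∈ rd.curveCompsIn s.1 ((RowRunFrame.ofRowGood m S₀ eng sc).T s))
    (curveComp_nonempty : ∀ (s : (RowRunFrame.ofRowGood m S₀ eng sc).St) (A C : Set (ULift.{u + 1} s.1.W)), C ∈ rd.curveCompsIn s.1 A → C.Nonempty)
    {s : (RowRunFrame.ofRowGood m S₀ eng sc).St} {x : ULift.{u + 1} s.1.W} (hx : x ∈ (RowRunFrame.ofRowGood m S₀ eng sc).T s)
    (hs : (eng.incidenceGood rd sc).toPIncidence.DoneN 5 s) : (eng.incidenceGood rd sc).η s x = 0 :=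
  (eng.guardedLawsT_incidenceGood rd sc eta_le_three dbl_map Eminus_map surf_map freeCurve_map curveComp_nonempty).eta_eq_zero_of_doneN_five hx hs

end RowEngine

end Summit.ResolutionOfSingularities.ResolutionOfSingularities.Theorems.SigmaMaxModificationsCorridor3.RowRunP

end
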